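import Mathlib
import Summits.CriticalPhenomena.PercolationContinuityZ3.Theorems.PercNearOneGluingNoHeavyLowerTailSpiderGluing
import Summits.CriticalPhenomena.PercolationContinuityZ3.Theorems.PercNearOneGluingNoHeavyLowerTailKNGoodSeriesEasy
import HarnessLib

/-!
# `NoHeavyLowerTail` (stmt-CriticalPhenomena-4575) — a leg ending in a FORK is a good unit, modulo the two-lonely-children
# gluing inequality GC at the fork

Support file (depth prover `prim-nh-dp-blobmono` gen 8, 2026-08-19; `--supports stmt-CriticalPhenomena-4575`).
No definitions, no named facts, no sorries.  First half of the typed socket asked for in the lead's memo LEAD-GEN7 §7(vii)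
("spiders whose legs end in forks ⟸ NEED({y,z})"); the spider-level statements are in
`PercNearOneGluingNoHeavyLowerTailForkedSpiderGluing.lean`.

After SPIDER GLUING (`SpiderGluing.spider_gluing`, `goodUnits_gluing`: observers whose units are Kozma–Nitzan-good in `G − o`
glue at rate `θ + t/θ`, uniformly in the number of legs and their lengths, connector legs allowed) the first unit of the tree
line NOT covered unconditionally is a leg of unbounded length whose TIP branches into two one-layer vertices (a FORK).  By
`knGood_of_chain_tip` its goodness reduces to goodness of the tip in `G ∖ prefix`, i.e. of an observer with relay hairs and two
pendant relay-stars glued to it; prim-hp-2's series identity (`KNGoodSeries.knGood_series_of_gluing`) reduces that to Theorem 4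
for the two stars plus ONE inequality, the gluing condition
  `GC(y,z):  P_{K+yz}(a₀ ↔ b) ≤ P_{K+yz}(y ↔ b) + Σ_{W ∩ A = ∅} P_{K+yz}(C(y) = W) · min_a P_{(K+yz)∖W}(a ↔ b)`,
`K` = the graph without the observer, `a₀` = a minimiser of `P_K(· ↔ b)`, `K+yz` = `K` with the pair `yz` made sure — prim-hp-2's
Conjecture M / GC, `prim-ineq-gen-7`'s `NEED({y,z})`, the lead's two-lonely-children kernel (LEAD-GEN7 §3a).  This file types
exactly that reduction:

* `knGood_twoUnits_hairs_of_gluing` — observer with relay hairs + two units good in `G − o` + GC ⇒ good;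
* `knGood_twoStars_hairs_of_gluing` — the same for two pendant relay-stars (Theorem 4 discharges the units): GC is the only
  hypothesis;
* `pinW_star_restrW_compl` — `(G ∖ S) − v = G ∖ (S ∪ {v})` at the level of weights;
* `knGood_of_chain_fork` — a leg (chain of non-relays with relay hairs) whose tip carries a fork is good in the ambient graph,
  modulo GC at the fork in `G ∖ leg`.
-/

namespace Summit.CriticalPhenomena.PercolationContinuityZ3.Theorems

open MeasureTheory Set
open Literature.Probability.LatticeModels (prodBernoulli)
open Literature.Probability.Percolation

noncomputable section
open Classical

variable {n : ℕ}

namespace SpiderGluing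

open KNGoodAux KNGoodHair RelayNbhd KNGoodSeries KNGoodSeriesEasy

/-! ### 9. Two units glued at an observer: goodness modulo the gluing inequality GC -/

/-- **Series step modulo GC, with relay hairs at the observer.**  `o ∉ A` whose positive pairs go to relays and to two
vertices `x ≠ y` (both `≠ o`), `b ≠ o`; `G − o := pinW w {pairs at o} ∅`; `a₀ ∈ A` minimises `P_{G−o}(· ↔ b)`; `(G−o, A, x, b)` and
`(G−o, A, y, b)` are good; and the GLUING INEQUALITY
`GC(x,y):  P_{(G−o)+xy}(a₀ ↔ b) ≤ P_{(G−o)+xy}(x ↔ b) + Σ_{W ∩ A = ∅} P_{(G−o)+xy}(C(x) = W) · min_a P_{((G−o)+xy)∖W}(a ↔ b)`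
holds (`(G−o)+xy` = the pair `xy` made sure).  Then `(G, A, o, b)` is good.  (`KNGoodSeries.knGood_series_of_gluing` after deleting
the relay hairs at `o` by `KNGoodHair.knGood_of_deleteHairs`.) [cite: KozmaNitzan2024, Thm. 5 (pp. 13–14) — extension] -/
theorem knGood_twoUnits_hairs_of_gluing (w : Sym2 (Fin n) → unitInterval) (A : Finset (Fin n)) (hA : A.Nonempty)
    (o x y a₀ b : Fin n) (ho : o ∉ A) (hxo : x ≠ o) (hyo : y ≠ o) (hxy : x ≠ y) (ha₀ : a₀ ∈ A) (hbo : b ≠ o)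
    (hoN : ∀ v : Fin n, v ≠ o → v ∉ A → v ≠ x → v ≠ y → w s(o, v) = 0)
    (hmin : ∀ a' ∈ A, (prodBernoulli (pinW w {e : Sym2 (Fin n) | o ∈ e ∧ ¬ e.IsDiag} ∅)).real (openConn a₀ b) ≤
      (prodBernoulli (pinW w {e : Sym2 (Fin n) | o ∈ e ∧ ¬ e.IsDiag} ∅)).real (openConn a' b))
    (hgoodx : KNGood (pinW w {e : Sym2 (Fin n) | o ∈ e ∧ ¬ e.IsDiag} ∅) A hA x b)
    (hgoody : KNGood (pinW w {e : Sym2 (Fin n) | o ∈ e ∧ ¬ e.IsDiag} ∅) A hA y b)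
    (hGC : (prodBernoulli (Function.update (pinW w {e : Sym2 (Fin n) | o ∈ e ∧ ¬ e.IsDiag} ∅) s(x, y) 1)).real
        (openConn a₀ b) ≤
      (prodBernoulli (Function.update (pinW w {e : Sym2 (Fin n) | o ∈ e ∧ ¬ e.IsDiag} ∅) s(x, y) 1)).real (openConn x b) +
        ∑ W ∈ nullSets A, (prodBernoulli (Function.update (pinW w {e : Sym2 (Fin n) | o ∈ e ∧ ¬ e.IsDiag} ∅) s(x, y) 1)).real
            (clusterIs x W) *
          A.inf' hA (fun a' => (prodBernoulli (Function.update (pinW w {e : Sym2 (Fin n) | o ∈ e ∧ ¬ e.IsDiag} ∅)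
            s(x, y) 1)).real (openConnIn ((↑W : Set (Fin n))ᶜ) a' b))) :
    KNGood w A hA o b := by
  -- delete the hairs at `o`
  set w' : Sym2 (Fin n) → unitInterval := fun e => if ∃ p ∈ A, e = s(o, p) then 0 else w e with hw'
  refine knGood_of_deleteHairs w A hA o b ho ?_
  rw [← hw']
  -- `G' − o = G − o`
  have hpin : pinW w' {e : Sym2 (Fin n) | o ∈ e ∧ ¬ e.IsDiag} ∅ = pinW w {e : Sym2 (Fin n) | o ∈ e ∧ ¬ e.IsDiag} ∅ := by
    refine pinW_star_eq_of_eqOff w w' o fun e he => ?_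
    rw [hw']; simp only
    rw [if_neg]
    rintro ⟨p, hp, rfl⟩
    exact he ⟨Sym2.mem_mk_left o p, fun hd => ho ((Sym2.mk_isDiag_iff.1 hd) ▸ hp)⟩
  refine knGood_series_of_gluing w' A hA o x y a₀ b ho hxo hyo hxy ha₀ hbo ?_ (by rw [hpin]; exact hmin)
    (by rw [hpin]; exact hgoodx) (by rw [hpin]; exact hgoody) (by rw [hpin]; exact hGC)
  intro v hvo hvx hvy
  rw [hw']; simp only
  by_cases hvA : v ∈ A
  · rw [if_pos ⟨v, hvA, rfl⟩]; rfl
  · rw [if_neg]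
    · exact congrArg Subtype.val (hoN v hvo hvA hvx hvy)
    · rintro ⟨p, hp, hvp⟩
      exact hvA ((Sym2.congr_right.1 hvp) ▸ hp)

/-- **Two pendant relay-stars glued at an observer with hairs: goodness modulo GC.**  `o ∉ A`; `x ≠ y` non-relays `≠ o`, not
adjacent; positive pairs at `o` go into `A ∪ {x, y}`, at `x` into `A ∪ {o}`, at `y` into `A ∪ {o}` (any number of ports, any
weights); `b ≠ o`; `a₀ ∈ A` minimises `P_{G−o}(· ↔ b)`; GC(x,y) as in `knGood_twoUnits_hairs_of_gluing`.  Then `(G, A, o, b)` is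
good — hence satisfies Kozma–Nitzan's (2) and Conjecture 1 at `o` (`KNGood.preFKG2`).  The stars are good in `G − o` by Theorem 4, so
GC is the ONLY hypothesis: this is the two-lonely-children kernel (LEAD-GEN7 §3a; prim-hp-2's Conjecture M / GC; `prim-ineq-gen-7`'s
`NEED({x,y})`) as a typed socket.  When `a₀` is no lonelier in `G − o` than one of the stars GC is a theorem
(`KNGoodSeriesEasy.knGood_twoStars_hairs_of_notLonelier`). [cite: KozmaNitzan2024, Thms. 4–5 (pp. 12–14) — extension] -/
theorem knGood_twoStars_hairs_of_gluing (w : Sym2 (Fin n) → unitInterval) (A : Finset (Fin n)) (hA : A.Nonempty)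
    (o x y a₀ b : Fin n) (ho : o ∉ A) (hx : x ∉ A) (hy' : y ∉ A) (hxo : x ≠ o) (hyo : y ≠ o) (hxy : x ≠ y) (ha₀ : a₀ ∈ A)
    (hbo : b ≠ o) (hxyw : w s(x, y) = 0)
    (hoN : ∀ v : Fin n, v ≠ o → v ∉ A → v ≠ x → v ≠ y → w s(o, v) = 0)
    (hxN : ∀ u : Fin n, u ≠ x → u ∉ A → u ≠ o → w s(x, u) = 0)
    (hyN : ∀ u : Fin n, u ≠ y → u ∉ A → u ≠ o → w s(y, u) = 0)
    (hmin : ∀ a' ∈ A, (prodBernoulli (pinW w {e : Sym2 (Fin n) | o ∈ e ∧ ¬ e.IsDiag} ∅)).real (openConn a₀ b) ≤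
      (prodBernoulli (pinW w {e : Sym2 (Fin n) | o ∈ e ∧ ¬ e.IsDiag} ∅)).real (openConn a' b))
    (hGC : (prodBernoulli (Function.update (pinW w {e : Sym2 (Fin n) | o ∈ e ∧ ¬ e.IsDiag} ∅) s(x, y) 1)).real
        (openConn a₀ b) ≤
      (prodBernoulli (Function.update (pinW w {e : Sym2 (Fin n) | o ∈ e ∧ ¬ e.IsDiag} ∅) s(x, y) 1)).real (openConn x b) +
        ∑ W ∈ nullSets A, (prodBernoulli (Function.update (pinW w {e : Sym2 (Fin n) | o ∈ e ∧ ¬ e.IsDiag} ∅) s(x, y) 1)).real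
            (clusterIs x W) *
          A.inf' hA (fun a' => (prodBernoulli (Function.update (pinW w {e : Sym2 (Fin n) | o ∈ e ∧ ¬ e.IsDiag} ∅)
            s(x, y) 1)).real (openConnIn ((↑W : Set (Fin n))ᶜ) a' b))) :
    KNGood w A hA o b := by
  set w0 := pinW w {e : Sym2 (Fin n) | o ∈ e ∧ ¬ e.IsDiag} ∅ with hw0
  -- Theorem 4 for the pendant stars `x`, `y` of `G − o`
  have hw0off : ∀ u v : Fin n, u ≠ o → v ≠ o → w0 s(u, v) = w s(u, v) := by
    intro u v hu hv
    have hmem : s(u, v) ∉ {e : Sym2 (Fin n) | o ∈ e ∧ ¬ e.IsDiag} := by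
      rintro ⟨hoe, -⟩
      rcases Sym2.mem_iff.1 hoe with h | h
      · exact hu h.symm
      · exact hv h.symm
    rw [hw0, pinW_apply_of_not_mem w ∅ hmem]
  have hgoodx : KNGood w0 A hA x b := by
    refine KozmaNitzan2024_thm4_good w0 A hA x b hx fun u hux huA => ?_
    by_cases huo : u = o
    · rw [huo, Sym2.eq_swap, hw0]; exact pinW_star_mk w hxo
    · by_cases huy : u = y
      · rw [huy, hw0off x y hxo hyo]; exact hxyw
      · rw [hw0off x u hxo huo]; exact hxN u hux huA huo
  have hgoody : KNGood w0 A hA y b := by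
    refine KozmaNitzan2024_thm4_good w0 A hA y b hy' fun u huy huA => ?_
    by_cases huo : u = o
    · rw [huo, Sym2.eq_swap, hw0]; exact pinW_star_mk w hyo
    · by_cases hux : u = x
      · rw [hux, Sym2.eq_swap, hw0off x y hxo hyo]; exact hxyw
      · rw [hw0off y u hyo huo]; exact hyN u huy huA huo
  exact knGood_twoUnits_hairs_of_gluing w A hA o x y a₀ b ho hxo hyo hxy ha₀ hbo hoN hmin hgoodx hgoody hGC

/-! ### 10. A leg ending in a FORK: chain + two pendant stars at the tip -/

/-- `(G ∖ S) − v = G ∖ (S ∪ {v})`: closing the (non-loop) pairs at `v` in the weights restricted to `Sᶜ` gives the weights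
restricted to `(insert v S)ᶜ`. [folklore] -/
theorem pinW_star_restrW_compl (S : Set (Fin n)) (v : Fin n) (w : Sym2 (Fin n) → unitInterval) :
    pinW (restrW Sᶜ w) {e : Sym2 (Fin n) | v ∈ e ∧ ¬ e.IsDiag} ∅ = restrW (insert v S)ᶜ w := by
  funext e
  by_cases hF : e ∈ {e : Sym2 (Fin n) | v ∈ e ∧ ¬ e.IsDiag}
  · rw [pinW_apply_of_mem_of_not_mem _ hF (Set.notMem_empty _)]
    have : e ∉ wireSet (insert v S)ᶜ := fun h => h.1 v hF.1 (Set.mem_insert v S)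
    rw [restrW_apply_of_not_mem w this]
  · rw [pinW_apply_of_not_mem _ ∅ hF]
    by_cases hS : e ∈ wireSet Sᶜ
    · have hvS : e ∈ wireSet (insert v S)ᶜ := by
        refine ⟨fun x hx hxS => ?_, hS.2⟩
        rcases (Set.mem_insert_iff.1 hxS) with rfl | hxS'
        · exact hF ⟨hx, hS.2⟩
        · exact hS.1 x hx hxS'
      rw [restrW_apply_of_mem w hS, restrW_apply_of_mem w hvS]
    · have hvS : e ∉ wireSet (insert v S)ᶜ := fun h =>
        hS ⟨fun x hx hxS => h.1 x hx (Set.mem_insert_of_mem v hxS), h.2⟩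
      rw [restrW_apply_of_not_mem w hS, restrW_apply_of_not_mem w hvS]

/-- **A leg ending in a fork is a good unit, modulo GC at the fork.**  `p : Fin (k+1) → Fin n` (`k ≥ 1`) injective, avoiding
`A`; chain condition below the tip (`i < k`: positive pairs of `p i` towards non-relays go to chain neighbours; relay hairs
arbitrary); the TIP `v = p k` is joined (besides relays and the chain) only to two PENDANT STARS `y ≠ z` (non-relays off the
chain, positive pairs only towards `A ∪ {v}`, any number of ports, any weights).  Let `G ∖ leg := restrW (range p)ᶜ w`,
`a₀ ∈ A` minimise `P_{G∖leg}(· ↔ b)`, and assume the gluing inequality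
`GC(y,z):  P_{(G∖leg)+yz}(a₀ ↔ b) ≤ P_{(G∖leg)+yz}(y ↔ b) + Σ_{W ∩ A = ∅} P_{(G∖leg)+yz}(C(y) = W) · min_a P_{((G∖leg)+yz)∖W}(a ↔ b)`.
Then `(G, A, p 0, b)` is good.  (`knGood_of_chain_tip` down the leg, `knGood_twoStars_hairs_of_gluing` at the tip.)  This is
the first unit of the tree line NOT covered unconditionally (SPIDER-GLUING Remark (c)); everything but GC is discharged here.
[cite: KozmaNitzan2024, Thms. 4–5 (pp. 12–14) — extension] -/
theorem knGood_of_chain_fork (A : Finset (Fin n)) (hA : A.Nonempty) (b : Fin n) (hb : b ∈ A)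
    (k : ℕ) (hk : 1 ≤ k) (w : Sym2 (Fin n) → unitInterval) (p : Fin (k + 1) → Fin n)
    (hpinj : Function.Injective p) (hpA : ∀ i, p i ∉ A)
    (hchain : ∀ (i : Fin (k + 1)) (u : Fin n), i.val < k → u ∉ A → u ≠ p i → w s(p i, u) ≠ 0 →
      ∃ l : Fin (k + 1), u = p l ∧ (l.val = i.val + 1 ∨ i.val = l.val + 1))
    (y z : Fin n) (hyA : y ∉ A) (hzA : z ∉ A) (hyz : y ≠ z) (hyp : ∀ i, y ≠ p i) (hzp : ∀ i, z ≠ p i)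
    (htipN : ∀ u : Fin n, u ∉ A → u ≠ y → u ≠ z → (∀ i, u ≠ p i) → w s(p (Fin.last k), u) = 0)
    (hyN : ∀ u : Fin n, u ≠ y → u ∉ A → u ≠ p (Fin.last k) → w s(y, u) = 0)
    (hzN : ∀ u : Fin n, u ≠ z → u ∉ A → u ≠ p (Fin.last k) → w s(z, u) = 0)
    (a₀ : Fin n) (ha₀ : a₀ ∈ A)
    (hmin : ∀ a ∈ A, (prodBernoulli (restrW (Set.range p)ᶜ w)).real (openConn a₀ b) ≤
      (prodBernoulli (restrW (Set.range p)ᶜ w)).real (openConn a b))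
    (hGC : (prodBernoulli (Function.update (restrW (Set.range p)ᶜ w) s(y, z) 1)).real (openConn a₀ b) ≤
      (prodBernoulli (Function.update (restrW (Set.range p)ᶜ w) s(y, z) 1)).real (openConn y b) +
        ∑ W ∈ nullSets A, (prodBernoulli (Function.update (restrW (Set.range p)ᶜ w) s(y, z) 1)).real (clusterIs y W) *
          A.inf' hA (fun a' => (prodBernoulli (Function.update (restrW (Set.range p)ᶜ w) s(y, z) 1)).real
            (openConnIn ((↑W : Set (Fin n))ᶜ) a' b))) :
    KNGood w A hA (p 0) b := by
  obtain ⟨m, rfl⟩ : ∃ m, k = m + 1 := ⟨k - 1, by omega⟩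
  -- the prefix and the tip
  set Pfx : Set (Fin n) := {v | ∃ i : Fin (m + 1 + 1), i.val ≤ m ∧ v = p i} with hPfx
  set v := p (Fin.last (m + 1)) with hv
  refine knGood_of_chain_tip A hA b hb m w p hpinj hpA ?_ ?_
  · intro i u him huA hui hw
    exact hchain i u (by omega) huA hui hw
  · -- the tip is good in `G ∖ prefix`: two pendant stars glued, modulo GC
    set w₁ := restrW Pfxᶜ w with hw₁
    have hrange : insert v Pfx = Set.range p := by
      ext u
      simp only [Set.mem_insert_iff, hPfx, Set.mem_setOf_eq, Set.mem_range]
      constructor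
      · rintro (rfl | ⟨i, -, rfl⟩)
        · exact ⟨Fin.last (m + 1), rfl⟩
        · exact ⟨i, rfl⟩
      · rintro ⟨i, rfl⟩
        by_cases hi : i.val ≤ m
        · exact Or.inr ⟨i, hi, rfl⟩
        · left
          have : i = Fin.last (m + 1) := Fin.ext (by rw [Fin.val_last]; omega)
          rw [this]
    have hpin : pinW w₁ {e : Sym2 (Fin n) | v ∈ e ∧ ¬ e.IsDiag} ∅ = restrW (Set.range p)ᶜ w := by
      rw [hw₁, pinW_star_restrW_compl, hrange]
    have hle : ∀ e, w₁ e ≤ w e := fun e => restrW_le _ w e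
    have hzero : ∀ e, w e = 0 → w₁ e = 0 := fun e he => le_antisymm ((hle e).trans he.le) bot_le
    have hvA : v ∉ A := hpA _
    have hbv : b ≠ v := fun h => hvA (h ▸ hb)
    refine knGood_twoStars_hairs_of_gluing w₁ A hA v y z a₀ b hvA hyA hzA (hyp _) (hzp _) hyz ha₀ hbv ?_ ?_ ?_ ?_
      (by rw [hpin]; exact hmin) (by rw [hpin]; exact hGC)
    · -- `w₁ s(y,z) = 0`
      exact hzero _ (hyN z hyz.symm hzA (hzp _))
    · -- pairs at the tip
      intro u huv huA huy huz
      by_cases hup : ∃ i, u = p i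
      · obtain ⟨i, rfl⟩ := hup
        have hi : i.val ≤ m := by
          by_contra hi
          apply huv
          have : i = Fin.last (m + 1) := Fin.ext (by rw [Fin.val_last]; omega)
          rw [this]
        rw [hw₁]
        exact restrW_apply_of_not_mem w fun h => (mk_mem_wireSet_iff.1 h).2.1 ⟨i, hi, rfl⟩
      · push Not at hup
        exact hzero _ (htipN u huA huy huz hup)
    · intro u huy huA huv
      exact hzero _ (hyN u huy huA huv)
    · intro u huz huA huv
      exact hzero _ (hzN u huz huA huv)

end SpiderGluing

end

end Summit.CriticalPhenomena.PercolationContinuityZ3.Theorems
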